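import Summits.SmoothPoincare4.SmoothPoincare4.Theorems.SymplecticOrigamiGromovRecognitionRelEndStubCapModelAux2
import Literature.Geometry.Symplectic.JHolomorphicMap
import Mathlib

/-!
# Flat leaves for `GromovRecognitionRelEnd` — flat lines as `J`-holomorphic spheres in the cap
charts (stub `stub_flatLeaves` of line `cross-cap-laurent`, crux
`SymplecticOrigami.GromovRecognitionRelEnd`, item stmt-SmoothPoincare4-11009; second auxiliary file)

Elementary pieces for presenting a flat complex line `{z₁ = c}` (or `{z₂ = c}`) of the standard
end, closed up by its point at infinity, as a `C^∞` sphere `ℂ ∪_{1/z} ℂ → X` in the wedge cap: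

* real-linear algebra of `ℝ⁴ = ℂ²` WITHOUT new definitions (existence statements only): the two
  complex coordinates `p ↦ p₀ + i p₁`, `p ↦ p₂ + i p₃` as real continuous linear maps
  `ℝ⁴ →L[ℝ] ℂ` intertwining `I4 = i ⊕ i` with `i` and jointly injective
  (`exists_clm_coord01`, `exists_clm_coord23`), and the two slice inclusions
  `ζ ↦ (0, 0, ζ)`, `ζ ↦ (ζ, 0, 0)` as `ℂ →L[ℝ] ℝ⁴` intertwining `i` with `I4`
  (`exists_clm_slice23`, `exists_clm_slice01`);
* **affine slices of a holomorphic chart are `J`-holomorphic curves** (`hasMFDerivAt_comp_slice`,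
  `contMDiff_comp_slice`, `isJHolomorphic_comp_slice`): if `dη ∘ I4 = J ∘ dη` on `D` and
  `s : ℂ → ℝ⁴` has constant derivative `S` with `S (i ζ) = I4 (S ζ)` and values in `D`, then
  `η ∘ s` is `C^∞` and `J`-holomorphic in the sense of
  `Literature.Geometry.Symplectic.IsJHolomorphic` (Hummel 1997, (3.1));
* **the second affine chart of the sphere** (`contMDiff_inversionGlue`): `z ↦ u (1/z)` extended
  over `0` by a map that is `C^∞` at `0` and agrees with it on a punctured neighbourhood is `C^∞`;
* `eq_of_forall_ne_zero_eq`: a map continuous at `0` and constant on `ℂ ∖ {0}` takes that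
  constant value at `0`.

Everything is proved; no definition, no named fact.

References: C. Hummel, *Gromov's compactness theorem for pseudo-holomorphic curves* (1997),
Ch. I §3 (3.1) [Hummel1997]; D. McDuff, D. Salamon, *Introduction to Symplectic Topology*,
3rd ed. (2017), §2.5, §4.5 [McDuffSalamon2017].
-/

noncomputable section

-- the registered namespace `Summit.SmoothPoincare4.SmoothPoincare4.Theorems…` repeats a component
set_option linter.dupNamespace false

open scoped Manifold ContDiff Topology
open Set Function Filter Literature.Geometry.Symplectic

namespace Summit.SmoothPoincare4.SmoothPoincare4.Theorems.GromovRecognitionRelEnd.CrossCapLaurent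

namespace FlatLeaves

open CapModel

/-! ## Real-linear algebra of `ℝ⁴ = ℂ²` (existence statements, no definitions) -/

/-- **The first complex coordinate** `p ↦ p₀ + i p₁` as a real continuous linear map
`ℝ⁴ →L[ℝ] ℂ`; it intertwines `I4 = i ⊕ i` with multiplication by `i`. [cite: McDuffSalamon2017, §2.5] -/
theorem exists_clm_coord01 : ∃ L : EuclideanSpace ℝ (Fin 4) →L[ℝ] ℂ, (∀ p : EuclideanSpace ℝ (Fin 4), L p = ⟨p 0, p 1⟩) ∧
    ∀ q : EuclideanSpace ℝ (Fin 4), L (I4 q) = Complex.I * L q := by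
  refine ⟨Complex.equivRealProdCLM.symm.toContinuousLinearMap.comp
      ((PiLp.proj 2 (fun _ : Fin 4 => ℝ) 0).prod (PiLp.proj 2 (fun _ : Fin 4 => ℝ) 1)), ?_, ?_⟩
  · intro p
    apply Complex.ext <;> simp
  · intro q
    apply Complex.ext <;> simp

/-- **The second complex coordinate** `p ↦ p₂ + i p₃` as a real continuous linear map
`ℝ⁴ →L[ℝ] ℂ`; it intertwines `I4 = i ⊕ i` with multiplication by `i`. [cite: McDuffSalamon2017, §2.5] -/
theorem exists_clm_coord23 : ∃ L : EuclideanSpace ℝ (Fin 4) →L[ℝ] ℂ, (∀ p : EuclideanSpace ℝ (Fin 4), L p = ⟨p 2, p 3⟩) ∧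
    ∀ q : EuclideanSpace ℝ (Fin 4), L (I4 q) = Complex.I * L q := by
  refine ⟨Complex.equivRealProdCLM.symm.toContinuousLinearMap.comp
      ((PiLp.proj 2 (fun _ : Fin 4 => ℝ) 2).prod (PiLp.proj 2 (fun _ : Fin 4 => ℝ) 3)), ?_, ?_⟩
  · intro p
    apply Complex.ext <;> simp
  · intro q
    apply Complex.ext <;> simp

/-- The two complex coordinates determine the vector: if `p₀ + i p₁ = 0` and `p₂ + i p₃ = 0`
then `p = 0`. [folklore] -/
theorem eq_zero_of_coords {L₁ L₂ : EuclideanSpace ℝ (Fin 4) →L[ℝ] ℂ} (h₁ : ∀ p : EuclideanSpace ℝ (Fin 4), L₁ p = ⟨p 0, p 1⟩)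
    (h₂ : ∀ p : EuclideanSpace ℝ (Fin 4), L₂ p = ⟨p 2, p 3⟩) {q : EuclideanSpace ℝ (Fin 4)} (hq₁ : L₁ q = 0) (hq₂ : L₂ q = 0) : q = 0 := by
  rw [h₁] at hq₁
  rw [h₂] at hq₂
  have e0 := congrArg Complex.re hq₁
  have e1 := congrArg Complex.im hq₁
  have e2 := congrArg Complex.re hq₂
  have e3 := congrArg Complex.im hq₂
  simp only [Complex.zero_re, Complex.zero_im] at e0 e1 e2 e3
  ext i
  fin_cases i
  · exact e0
  · exact e1
  · exact e2
  · exact e3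

/-- A complex coordinate vanishes iff both of its real coordinates vanish. [folklore] -/
theorem coord_eq_zero_iff {L : EuclideanSpace ℝ (Fin 4) →L[ℝ] ℂ} {i j : Fin 4} (h : ∀ p : EuclideanSpace ℝ (Fin 4), L p = ⟨p i, p j⟩)
    (p : EuclideanSpace ℝ (Fin 4)) : L p = 0 ↔ p i = 0 ∧ p j = 0 := by
  rw [h, Complex.ext_iff]
  simp

/-- **The slice inclusion of the second factor** `ζ ↦ (0, 0, ζ)` as a real continuous linear
map `ℂ →L[ℝ] ℝ⁴`; it intertwines `i` with `I4`. [cite: McDuffSalamon2017, §2.5] -/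
theorem exists_clm_slice23 : ∃ S : ℂ →L[ℝ] EuclideanSpace ℝ (Fin 4),
    (∀ ζ : ℂ, S ζ = WithLp.toLp 2 ![0, 0, ζ.re, ζ.im]) ∧
    ∀ ζ : ℂ, S (Complex.I * ζ) = I4 (S ζ) := by
  refine ⟨LinearMap.toContinuousLinearMap
      { toFun := fun ζ : ℂ => (WithLp.toLp 2 ![0, 0, ζ.re, ζ.im] : EuclideanSpace ℝ (Fin 4))
        map_add' := fun ζ ξ => by ext i; fin_cases i <;> simp
        map_smul' := fun c ζ => by ext i; fin_cases i <;> simp }, fun ζ => rfl, ?_⟩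
  intro ζ
  ext i
  fin_cases i <;> simp [I4_apply]

/-- **The slice inclusion of the first factor** `ζ ↦ (ζ, 0, 0)` as a real continuous linear
map `ℂ →L[ℝ] ℝ⁴`; it intertwines `i` with `I4`. [cite: McDuffSalamon2017, §2.5] -/
theorem exists_clm_slice01 : ∃ S : ℂ →L[ℝ] EuclideanSpace ℝ (Fin 4),
    (∀ ζ : ℂ, S ζ = WithLp.toLp 2 ![ζ.re, ζ.im, 0, 0]) ∧
    ∀ ζ : ℂ, S (Complex.I * ζ) = I4 (S ζ) := by
  refine ⟨LinearMap.toContinuousLinearMap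
      { toFun := fun ζ : ℂ => (WithLp.toLp 2 ![ζ.re, ζ.im, 0, 0] : EuclideanSpace ℝ (Fin 4))
        map_add' := fun ζ ξ => by ext i; fin_cases i <;> simp
        map_smul' := fun c ζ => by ext i; fin_cases i <;> simp }, fun ζ => rfl, ?_⟩
  intro ζ
  ext i
  fin_cases i <;> simp [I4_apply]

/-- The slice `t ↦ (a₀, a₁, t)` of the second factor has the constant derivative
`ζ ↦ (0, 0, ζ)`. [folklore] -/
theorem hasFDerivAt_slice23 {S : ℂ →L[ℝ] EuclideanSpace ℝ (Fin 4)}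
    (hS : ∀ ζ : ℂ, S ζ = WithLp.toLp 2 ![0, 0, ζ.re, ζ.im]) (a₀ a₁ : ℝ) (z : ℂ) :
    HasFDerivAt (fun t : ℂ => (WithLp.toLp 2 ![a₀, a₁, t.re, t.im] : EuclideanSpace ℝ (Fin 4))) S z := by
  have h : (fun t : ℂ => (WithLp.toLp 2 ![a₀, a₁, t.re, t.im] : EuclideanSpace ℝ (Fin 4))) =
      fun t => (WithLp.toLp 2 ![a₀, a₁, 0, 0] : EuclideanSpace ℝ (Fin 4)) + S t := by
    funext t
    rw [hS]
    ext i
    fin_cases i <;> simp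
  rw [h]
  exact S.hasFDerivAt.const_add _

/-- The slice `t ↦ (t, a₂, a₃)` of the first factor has the constant derivative
`ζ ↦ (ζ, 0, 0)`. [folklore] -/
theorem hasFDerivAt_slice01 {S : ℂ →L[ℝ] EuclideanSpace ℝ (Fin 4)}
    (hS : ∀ ζ : ℂ, S ζ = WithLp.toLp 2 ![ζ.re, ζ.im, 0, 0]) (a₂ a₃ : ℝ) (z : ℂ) :
    HasFDerivAt (fun t : ℂ => (WithLp.toLp 2 ![t.re, t.im, a₂, a₃] : EuclideanSpace ℝ (Fin 4))) S z := by
  have h : (fun t : ℂ => (WithLp.toLp 2 ![t.re, t.im, a₂, a₃] : EuclideanSpace ℝ (Fin 4))) =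
      fun t => (WithLp.toLp 2 ![0, 0, a₂, a₃] : EuclideanSpace ℝ (Fin 4)) + S t := by
    funext t
    rw [hS]
    ext i
    fin_cases i <;> simp
  rw [h]
  exact S.hasFDerivAt.const_add _

/-- Near `0` the squared modulus is small: `|t|² < c` eventually, for `c > 0`. [folklore] -/
theorem eventually_normSq_lt {c : ℝ} (hc : 0 < c) : ∀ᶠ t in 𝓝 (0 : ℂ), Complex.normSq t < c := by
  have h : Tendsto Complex.normSq (𝓝 (0 : ℂ)) (𝓝 0) := by
    simpa using Complex.continuous_normSq.tendsto 0
  exact h.eventually_lt_const hc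

/-! ## Affine slices of a holomorphic chart are `J`-holomorphic curves -/

section Slice

variable {E' : Type*} [NormedAddCommGroup E'] [NormedSpace ℝ E'] {H' : Type*}
  [TopologicalSpace H'] {I' : ModelWithCorners ℝ E' H'} {X : Type*} [TopologicalSpace X]
  [ChartedSpace H' X] {η : EuclideanSpace ℝ (Fin 4) → X} {D : Set (EuclideanSpace ℝ (Fin 4))} {s : ℂ → EuclideanSpace ℝ (Fin 4)} {S : ℂ →L[ℝ] EuclideanSpace ℝ (Fin 4)}

/-- **Chain rule along a slice**: if `s` has derivative `S` at `z` and `η` is differentiable at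
`s z`, then `d(η ∘ s)_z = dη_{s z} ∘ S`. [folklore] -/
theorem hasMFDerivAt_comp_slice {z : ℂ} (hs : HasFDerivAt s S z)
    (hη : MDifferentiableAt 𝓘(ℝ, EuclideanSpace ℝ (Fin 4)) I' η (s z)) :
    HasMFDerivAt 𝓘(ℝ, ℂ) I' (fun t => η (s t)) z ((mfderiv 𝓘(ℝ, EuclideanSpace ℝ (Fin 4)) I' η (s z)).comp S) :=
  hη.hasMFDerivAt.comp z (hasMFDerivAt_iff_hasFDerivAt.2 hs)

/-- `d(η ∘ s)_z ζ = dη_{s z} (S ζ)`. [folklore] -/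
theorem mfderiv_comp_slice_apply {z : ℂ} (hs : HasFDerivAt s S z)
    (hη : MDifferentiableAt 𝓘(ℝ, EuclideanSpace ℝ (Fin 4)) I' η (s z)) (ζ : ℂ) :
    mfderiv 𝓘(ℝ, ℂ) I' (fun t => η (s t)) z ζ = mfderiv 𝓘(ℝ, EuclideanSpace ℝ (Fin 4)) I' η (s z) (S ζ) := by
  rw [(hasMFDerivAt_comp_slice hs hη).mfderiv]
  rfl

omit [TopologicalSpace X] [ChartedSpace H' X] in
/-- A map `ℂ → ℝ⁴` with a constant derivative is `C^∞` (it is affine). [folklore] -/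
theorem contDiff_of_hasFDerivAt_const (hs : ∀ z, HasFDerivAt s S z) : ContDiff ℝ ∞ s := by
  rw [contDiff_infty_iff_fderiv]
  refine ⟨fun t => (hs t).differentiableAt, ?_⟩
  have hS : fderiv ℝ s = fun _ => S := funext fun t => (hs t).fderiv
  rw [hS]
  exact contDiff_const

/-- **A slice of a `C^∞` chart is a `C^∞` curve.** [folklore] -/
theorem contMDiff_comp_slice (hD : ∀ p ∈ D, ContMDiffAt 𝓘(ℝ, EuclideanSpace ℝ (Fin 4)) I' ∞ η p)
    (hs : ∀ z, HasFDerivAt s S z) (hmem : ∀ z, s z ∈ D) :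
    ContMDiff 𝓘(ℝ, ℂ) I' ∞ (fun t => η (s t)) := fun z =>
  (hD _ (hmem z)).comp z (contDiff_of_hasFDerivAt_const hs).contMDiff.contMDiffAt

/-- **A slice of a holomorphic chart is a `J`-holomorphic curve** (Hummel 1997, (3.1):
`du ∘ i = J ∘ du`): if `dη (I4 q) = J (dη q)` on `D`, `ds = S` with `S (i ζ) = I4 (S ζ)`, and
`s` takes values in `D`, then `η ∘ s` is `J`-holomorphic. [cite: Hummel1997, Ch. I §3, eq. (3.1)] -/
theorem isJHolomorphic_comp_slice {JX : ∀ y : X, TangentSpace I' y →L[ℝ] TangentSpace I' y}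
    (hD : ∀ p ∈ D, MDifferentiableAt 𝓘(ℝ, EuclideanSpace ℝ (Fin 4)) I' η p)
    (hhol : ∀ p ∈ D, ∀ q : EuclideanSpace ℝ (Fin 4),
      JX (η p) (mfderiv 𝓘(ℝ, EuclideanSpace ℝ (Fin 4)) I' η p q) = mfderiv 𝓘(ℝ, EuclideanSpace ℝ (Fin 4)) I' η p (I4 q))
    (hs : ∀ z, HasFDerivAt s S z) (hS : ∀ ζ : ℂ, S (Complex.I * ζ) = I4 (S ζ))
    (hmem : ∀ z, s z ∈ D) :
    IsJHolomorphic I' JX (fun t => η (s t)) := by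
  intro z ζ
  rw [mfderiv_comp_slice_apply (hs z) (hD _ (hmem z)),
    mfderiv_comp_slice_apply (hs z) (hD _ (hmem z)), hS, ← hhol _ (hmem z)]

end Slice

/-! ## The second affine chart: gluing `u (1/z)` over `z = 0` -/

section Glue

variable {E' : Type*} [NormedAddCommGroup E'] [NormedSpace ℝ E'] {H' : Type*}
  [TopologicalSpace H'] {I' : ModelWithCorners ℝ E' H'} {X : Type*} [TopologicalSpace X]
  [ChartedSpace H' X]

/-- **The chart at infinity of a sphere.** If `u : ℂ → X` is `C^∞`, `w` is `C^∞` at `0` and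
`w z = u (1/z)` on a punctured neighbourhood of `0`, then
`v z := if z = 0 then w 0 else u (1/z)` is `C^∞` on all of `ℂ`. [folklore] -/
theorem contMDiff_inversionGlue {u w : ℂ → X} (hu : ContMDiff 𝓘(ℝ, ℂ) I' ∞ u)
    (hw : ContMDiffAt 𝓘(ℝ, ℂ) I' ∞ w 0) (hagree : ∀ᶠ z in 𝓝 (0 : ℂ), z ≠ 0 → w z = u z⁻¹) :
    ContMDiff 𝓘(ℝ, ℂ) I' ∞ (fun z : ℂ => if z = 0 then w 0 else u z⁻¹) := by
  intro z
  by_cases hz : z = 0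
  · subst hz
    refine hw.congr_of_eventuallyEq ?_
    filter_upwards [hagree] with t ht
    by_cases ht0 : t = 0
    · subst ht0
      simp
    · rw [if_neg ht0]
      exact (ht ht0).symm
  · have hinv : ContMDiffAt 𝓘(ℝ, ℂ) 𝓘(ℝ, ℂ) ∞ (fun t : ℂ => t⁻¹) z :=
      (contDiffAt_inv ℝ hz).contMDiffAt
    have h : ContMDiffAt 𝓘(ℝ, ℂ) I' ∞ (u ∘ fun t : ℂ => t⁻¹) z := (hu z⁻¹).comp z hinv
    refine h.congr_of_eventuallyEq ?_
    filter_upwards [isOpen_ne.mem_nhds hz] with t ht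
    rw [if_neg ht]
    rfl

omit [TopologicalSpace X] in
/-- The glued chart is `u (1/z)` off `0`. [folklore] -/
theorem inversionGlue_of_ne_zero {u w : ℂ → X} {z : ℂ} (hz : z ≠ 0) :
    (fun z : ℂ => if z = 0 then w 0 else u z⁻¹) z = u z⁻¹ := by
  simp only [if_neg hz]

omit [TopologicalSpace X] in
/-- The glued chart is `w 0` at `0`. [folklore] -/
theorem inversionGlue_zero {u w : ℂ → X} :
    (fun z : ℂ => if z = 0 then w 0 else u z⁻¹) 0 = w 0 := by
  simp

/-- **A map continuous at `0` and constant on `ℂ ∖ {0}` takes that value at `0`** (`ℂ ∖ {0}`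
accumulates at `0`; limits in a Hausdorff space are unique). [folklore] -/
theorem eq_of_forall_ne_zero_eq [T2Space X] {f : ℂ → X} {c : X} (hf : ContinuousAt f 0)
    (h : ∀ t : ℂ, t ≠ 0 → f t = c) : f 0 = c := by
  have h1 : Tendsto f (𝓝[≠] (0 : ℂ)) (𝓝 (f 0)) := hf.continuousWithinAt.tendsto
  have h2 : Tendsto f (𝓝[≠] (0 : ℂ)) (𝓝 c) :=
    tendsto_const_nhds.congr' (eventually_nhdsWithin_of_forall fun t ht => (h t ht).symm)
  exact tendsto_nhds_unique h1 h2

end Glue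

end FlatLeaves

/-- **Registered helper sub-goal `helper_flatLeavesSliceHolomorphic`** (second auxiliary file of
stub `stub_flatLeaves`): a slice `z ↦ η (s z)` of a chart `η : ℝ⁴ → X` that is differentiable and
intertwines `i ⊕ i` with `J` on a set `D` containing the slice, along an `s` with constant
derivative `S`, `S (i ζ) = (i ⊕ i) (S ζ)`, is a `J`-holomorphic curve. [cite: Hummel1997, Ch. I §3, eq. (3.1)] -/
theorem helper_flatLeavesSliceHolomorphic : ∀ (X : Type) [TopologicalSpace X]
    [ChartedSpace (EuclideanSpace ℝ (Fin 4)) X]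
    (JX : ∀ y : X, TangentSpace (𝓡 4) y →L[ℝ] TangentSpace (𝓡 4) y)
    (η : EuclideanSpace ℝ (Fin 4) → X) (D : Set (EuclideanSpace ℝ (Fin 4)))
    (s : ℂ → EuclideanSpace ℝ (Fin 4)) (S : ℂ →L[ℝ] EuclideanSpace ℝ (Fin 4)),
    (∀ p ∈ D, MDifferentiableAt 𝓘(ℝ, EuclideanSpace ℝ (Fin 4)) (𝓡 4) η p) →
    (∀ p ∈ D, ∀ q : EuclideanSpace ℝ (Fin 4),
      JX (η p) (mfderiv 𝓘(ℝ, EuclideanSpace ℝ (Fin 4)) (𝓡 4) η p q) =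
        mfderiv 𝓘(ℝ, EuclideanSpace ℝ (Fin 4)) (𝓡 4) η p
          (WithLp.toLp 2 ![-(q 1), q 0, -(q 3), q 2])) →
    (∀ z, HasFDerivAt s S z) →
    (∀ ζ : ℂ, S (Complex.I * ζ) = WithLp.toLp 2 ![-(S ζ 1), S ζ 0, -(S ζ 3), S ζ 2]) →
    (∀ z, s z ∈ D) →
    Literature.Geometry.Symplectic.IsJHolomorphic (𝓡 4) JX (fun t => η (s t)) :=
  fun _ _ _ _ _ _ _ _ hD hhol hs hS hmem => FlatLeaves.isJHolomorphic_comp_slice hD hhol hs hS hmem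

end Summit.SmoothPoincare4.SmoothPoincare4.Theorems.GromovRecognitionRelEnd.CrossCapLaurent
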